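import Mathlib
import Literature.MathematicalPhysics.QuantumFieldTheory.LatticeMirrorNormals
import HarnessLib

/-!
# Any five of the nine lattice mirror normals of `ℤ³` span `ℝ³`: three good directions off a finite set

Topic `Literature/MathematicalPhysics/QuantumFieldTheory` (companion of `LatticeMirrorNormals.lean`).
The nine lattice mirror normals of `ℤ³` are `e₀, e₁, e₂, e₀ + e₁, e₀ + e₂, e₁ + e₂, e₀ - e₁,
e₀ - e₂, e₁ - e₂` (the positive roots of `B₃`).  A plane through the origin contains at most four of
the nine lines (a `B₂` quadruple), so ANY FIVE of the nine normals span `ℝ³`; equivalently, for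
every subset `G` of the nine, either `G` or its complement contains a linearly independent triple
(`nineNormals_cover`, a finite check over the `68` independent triples `nineNormals_det_ne_zero`,
both by `decide`).

Consequence (`exists_finset_three_good_latticeNormals`): for every finite family of points
`y : Fin m → ℝ³` there is a FINITE set `F ⊆ ℝ³` such that every `x ∉ F` has three linearly
independent lattice normals `n₁, n₂, n₃` that are GOOD at `x`, i.e. `⟪x, n_k⟫ ≠ ⟪y i, n_k⟫` for
all `i` — the heights of `x` along `n_k` avoid the heights of the `y i`.  (If the bad normals at `x`
contain an independent triple, `x` solves a uniquely solvable `3 × 3` system with right-hand sides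
among the finitely many heights of the `y i`; otherwise the good normals contain one.)  This is the
counting step of the analyticity of reflection-positive Euclidean correlation functions off a
finite set (Glimm–Jaffe §6.1 with the nine mirrors of `ℤ³`).

## References
* J. E. Humphreys, *Reflection Groups and Coxeter Groups* (CUP 1990), §2.10 (root system `B₃`).
  [folklore]
* J. Glimm, A. Jaffe, *Quantum Physics* (2nd ed. 1987), §6.1. [GlimmJaffe1987]
-/

noncomputable section

open scoped InnerProductSpace BigOperators

namespace Literature.MathematicalPhysics.QuantumFieldTheory

/-! ### The finite checks -/

/-- Each of the `68` listed triples of the nine lattice normals `e₀, e₁, e₂, e₀ + e₁, e₀ + e₂,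
e₁ + e₂, e₀ - e₁, e₀ - e₂, e₁ - e₂` (integer coordinates) has nonzero `3 × 3` determinant. [folklore] -/
theorem nineNormals_det_ne_zero : ∀ t ∈ ([(0, 1, 2), (0, 1, 4), (0, 1, 5), (0, 1, 7), (0, 1, 8), (0, 2, 3), (0, 2, 5),
  (0, 2, 6), (0, 2, 8), (0, 3, 4), (0, 3, 5), (0, 3, 7), (0, 3, 8), (0, 4, 5), (0, 4, 6), (0, 4, 8),
  (0, 5, 6), (0, 5, 7), (0, 5, 8), (0, 6, 7), (0, 6, 8), (0, 7, 8), (1, 2, 3), (1, 2, 4),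
  (1, 2, 6), (1, 2, 7), (1, 3, 4), (1, 3, 5), (1, 3, 7), (1, 3, 8), (1, 4, 5), (1, 4, 6),
  (1, 4, 7), (1, 4, 8), (1, 5, 6), (1, 5, 7), (1, 6, 7), (1, 6, 8), (1, 7, 8), (2, 3, 4),
  (2, 3, 5), (2, 3, 6), (2, 3, 7), (2, 3, 8), (2, 4, 5), (2, 4, 6), (2, 4, 8), (2, 5, 6),
  (2, 5, 7), (2, 6, 7), (2, 6, 8), (2, 7, 8), (3, 4, 5), (3, 4, 6), (3, 4, 7), (3, 5, 6),
  (3, 5, 8), (3, 6, 7), (3, 6, 8), (3, 7, 8), (4, 5, 7), (4, 5, 8), (4, 6, 7), (4, 6, 8),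
  (4, 7, 8), (5, 6, 7), (5, 6, 8), (5, 7, 8)] : List (Fin 9 × Fin 9 × Fin 9)),
    (fun u v w : Fin 3 → ℤ =>
      u 0 * (v 1 * w 2 - v 2 * w 1) - u 1 * (v 0 * w 2 - v 2 * w 0) + u 2 * (v 0 * w 1 - v 1 * w 0))
      ((![![1, 0, 0], ![0, 1, 0], ![0, 0, 1], ![1, 1, 0], ![1, 0, 1], ![0, 1, 1],
      ![1, -1, 0], ![1, 0, -1], ![0, 1, -1]] : Fin 9 → Fin 3 → ℤ) t.1) ((![![1, 0, 0], ![0, 1, 0], ![0, 0, 1], ![1, 1, 0], ![1, 0, 1], ![0, 1, 1],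
      ![1, -1, 0], ![1, 0, -1], ![0, 1, -1]] : Fin 9 → Fin 3 → ℤ) t.2.1) ((![![1, 0, 0], ![0, 1, 0], ![0, 0, 1], ![1, 1, 0], ![1, 0, 1], ![0, 1, 1],
      ![1, -1, 0], ![1, 0, -1], ![0, 1, -1]] : Fin 9 → Fin 3 → ℤ) t.2.2) ≠ 0 := by
  decide +kernel

/-- **Any five of the nine normals span**, in covering form: for every Boolean marking of the nine
normals, if no listed independent triple is entirely marked then some listed independent triple is
entirely unmarked (nine Booleans, checked by `decide`). [folklore] -/
theorem nineNormals_cover_bool : ∀ b₀ b₁ b₂ b₃ b₄ b₅ b₆ b₇ b₈ : Bool,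
    (List.all ([(0, 1, 2), (0, 1, 4), (0, 1, 5), (0, 1, 7), (0, 1, 8), (0, 2, 3), (0, 2, 5),
  (0, 2, 6), (0, 2, 8), (0, 3, 4), (0, 3, 5), (0, 3, 7), (0, 3, 8), (0, 4, 5), (0, 4, 6), (0, 4, 8),
  (0, 5, 6), (0, 5, 7), (0, 5, 8), (0, 6, 7), (0, 6, 8), (0, 7, 8), (1, 2, 3), (1, 2, 4),
  (1, 2, 6), (1, 2, 7), (1, 3, 4), (1, 3, 5), (1, 3, 7), (1, 3, 8), (1, 4, 5), (1, 4, 6),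
  (1, 4, 7), (1, 4, 8), (1, 5, 6), (1, 5, 7), (1, 6, 7), (1, 6, 8), (1, 7, 8), (2, 3, 4),
  (2, 3, 5), (2, 3, 6), (2, 3, 7), (2, 3, 8), (2, 4, 5), (2, 4, 6), (2, 4, 8), (2, 5, 6),
  (2, 5, 7), (2, 6, 7), (2, 6, 8), (2, 7, 8), (3, 4, 5), (3, 4, 6), (3, 4, 7), (3, 5, 6),
  (3, 5, 8), (3, 6, 7), (3, 6, 8), (3, 7, 8), (4, 5, 7), (4, 5, 8), (4, 6, 7), (4, 6, 8),
  (4, 7, 8), (5, 6, 7), (5, 6, 8), (5, 7, 8)] : List (Fin 9 × Fin 9 × Fin 9)) fun t => !((![b₀, b₁, b₂, b₃, b₄, b₅, b₆, b₇, b₈] : Fin 9 → Bool) t.1 &&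
      (![b₀, b₁, b₂, b₃, b₄, b₅, b₆, b₇, b₈] : Fin 9 → Bool) t.2.1 &&
      (![b₀, b₁, b₂, b₃, b₄, b₅, b₆, b₇, b₈] : Fin 9 → Bool) t.2.2)) = true →
    (List.any
      ([(0, 1, 2), (0, 1, 4), (0, 1, 5), (0, 1, 7), (0, 1, 8), (0, 2, 3), (0, 2, 5),
  (0, 2, 6), (0, 2, 8), (0, 3, 4), (0, 3, 5), (0, 3, 7), (0, 3, 8), (0, 4, 5), (0, 4, 6), (0, 4, 8),
  (0, 5, 6), (0, 5, 7), (0, 5, 8), (0, 6, 7), (0, 6, 8), (0, 7, 8), (1, 2, 3), (1, 2, 4),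
  (1, 2, 6), (1, 2, 7), (1, 3, 4), (1, 3, 5), (1, 3, 7), (1, 3, 8), (1, 4, 5), (1, 4, 6),
  (1, 4, 7), (1, 4, 8), (1, 5, 6), (1, 5, 7), (1, 6, 7), (1, 6, 8), (1, 7, 8), (2, 3, 4),
  (2, 3, 5), (2, 3, 6), (2, 3, 7), (2, 3, 8), (2, 4, 5), (2, 4, 6), (2, 4, 8), (2, 5, 6),
  (2, 5, 7), (2, 6, 7), (2, 6, 8), (2, 7, 8), (3, 4, 5), (3, 4, 6), (3, 4, 7), (3, 5, 6),
  (3, 5, 8), (3, 6, 7), (3, 6, 8), (3, 7, 8), (4, 5, 7), (4, 5, 8), (4, 6, 7), (4, 6, 8),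
  (4, 7, 8), (5, 6, 7), (5, 6, 8), (5, 7, 8)] : List (Fin 9 × Fin 9 × Fin 9)) fun t => !(![b₀, b₁, b₂, b₃, b₄, b₅, b₆, b₇, b₈] : Fin 9 → Bool) t.1 &&
      !(![b₀, b₁, b₂, b₃, b₄, b₅, b₆, b₇, b₈] : Fin 9 → Bool) t.2.1 &&
      !(![b₀, b₁, b₂, b₃, b₄, b₅, b₆, b₇, b₈] : Fin 9 → Bool) t.2.2) = true := by
  decide +kernel

/-- The covering form for an arbitrary Boolean marking `B : Fin 9 → Bool` of a list of triples
satisfying the nine-Boolean covering statement (`nineNormals_cover_bool`). [folklore] -/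
theorem cover_of_cover_bool (L : List (Fin 9 × Fin 9 × Fin 9))
    (hL : ∀ b₀ b₁ b₂ b₃ b₄ b₅ b₆ b₇ b₈ : Bool,
      (List.all L fun t => !((![b₀, b₁, b₂, b₃, b₄, b₅, b₆, b₇, b₈] : Fin 9 → Bool) t.1 &&
        (![b₀, b₁, b₂, b₃, b₄, b₅, b₆, b₇, b₈] : Fin 9 → Bool) t.2.1 &&
        (![b₀, b₁, b₂, b₃, b₄, b₅, b₆, b₇, b₈] : Fin 9 → Bool) t.2.2)) = true →
      (List.any L fun t => !(![b₀, b₁, b₂, b₃, b₄, b₅, b₆, b₇, b₈] : Fin 9 → Bool) t.1 &&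
        !(![b₀, b₁, b₂, b₃, b₄, b₅, b₆, b₇, b₈] : Fin 9 → Bool) t.2.1 &&
        !(![b₀, b₁, b₂, b₃, b₄, b₅, b₆, b₇, b₈] : Fin 9 → Bool) t.2.2) = true)
    (B : Fin 9 → Bool) (h : ∀ t ∈ L, ¬ (B t.1 = true ∧ B t.2.1 = true ∧ B t.2.2 = true)) :
    ∃ t ∈ L, B t.1 = false ∧ B t.2.1 = false ∧ B t.2.2 = false := by
  have aux₁ : ∀ b₁ b₂ b₃ : Bool, ¬ (b₁ = true ∧ b₂ = true ∧ b₃ = true) →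
      (!(b₁ && b₂ && b₃)) = true := by decide
  have aux₂ : ∀ b₁ b₂ b₃ : Bool, (!b₁ && !b₂ && !b₃) = true →
      b₁ = false ∧ b₂ = false ∧ b₃ = false := by decide
  have h1 : (List.all L fun t => !(B t.1 && B t.2.1 && B t.2.2)) = true :=
    List.all_eq_true.2 fun t ht => aux₁ _ _ _ (h t ht)
  have hB : (![B 0, B 1, B 2, B 3, B 4, B 5, B 6, B 7, B 8] : Fin 9 → Bool) = B := by
    funext i; fin_cases i <;> rfl
  have key := hL (B 0) (B 1) (B 2) (B 3) (B 4) (B 5) (B 6) (B 7) (B 8)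
  rw [hB] at key
  obtain ⟨t, ht, hbt⟩ := List.any_eq_true.1 (key h1)
  exact ⟨t, ht, aux₂ _ _ _ hbt⟩

/-! ### The nine normals as vectors of `ℝ³` -/

/-- The nine vectors `e₀, e₁, e₂, e₀ + e₁, e₀ + e₂, e₁ + e₂, e₀ - e₁, e₀ - e₂, e₁ - e₂` (real
coordinates from the integer table) are lattice mirror normals. [folklore] -/
theorem nineNormals_mem (k : Fin 9) :
    (WithLp.toLp 2 fun i : Fin 3 => (((![![1, 0, 0], ![0, 1, 0], ![0, 0, 1], ![1, 1, 0], ![1, 0, 1], ![0, 1, 1],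
      ![1, -1, 0], ![1, 0, -1], ![0, 1, -1]] : Fin 9 → Fin 3 → ℤ) k i : ℤ) : ℝ) : EuclideanSpace ℝ (Fin 3)) ∈
      latticeMirrorNormals (Fin 3) := by
  fin_cases k
  · refine ⟨0, 1, by decide, Or.inl ?_⟩
    ext l; fin_cases l <;> simp
  · refine ⟨1, 0, by decide, Or.inl ?_⟩
    ext l; fin_cases l <;> simp
  · refine ⟨2, 0, by decide, Or.inl ?_⟩
    ext l; fin_cases l <;> simp
  · refine ⟨0, 1, by decide, Or.inr (Or.inl ?_)⟩
    ext l; fin_cases l <;> simp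
  · refine ⟨0, 2, by decide, Or.inr (Or.inl ?_)⟩
    ext l; fin_cases l <;> simp
  · refine ⟨1, 2, by decide, Or.inr (Or.inl ?_)⟩
    ext l; fin_cases l <;> simp
  · refine ⟨0, 1, by decide, Or.inr (Or.inr ?_)⟩
    ext l; fin_cases l <;> simp
  · refine ⟨0, 2, by decide, Or.inr (Or.inr ?_)⟩
    ext l; fin_cases l <;> simp
  · refine ⟨1, 2, by decide, Or.inr (Or.inr ?_)⟩
    ext l; fin_cases l <;> simp

/-- Three integer vectors with nonzero `3 × 3` determinant are linearly independent in `ℝ³`.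
[folklore] -/
theorem linearIndependent_of_det3_ne_zero {u v w : Fin 3 → ℤ}
    (h : u 0 * (v 1 * w 2 - v 2 * w 1) - u 1 * (v 0 * w 2 - v 2 * w 0) +
      u 2 * (v 0 * w 1 - v 1 * w 0) ≠ 0) :
    LinearIndependent ℝ ![(WithLp.toLp 2 fun i : Fin 3 => ((u i : ℤ) : ℝ) : EuclideanSpace ℝ (Fin 3)),
      (WithLp.toLp 2 fun i : Fin 3 => ((v i : ℤ) : ℝ) : EuclideanSpace ℝ (Fin 3)),
      (WithLp.toLp 2 fun i : Fin 3 => ((w i : ℤ) : ℝ) : EuclideanSpace ℝ (Fin 3))] := by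
  -- the real matrix with rows `u, v, w`
  set M : Matrix (Fin 3) (Fin 3) ℝ := Matrix.of fun r i => ((![u, v, w] r i : ℤ) : ℝ) with hM
  have hdet : M.det = ((u 0 * (v 1 * w 2 - v 2 * w 1) - u 1 * (v 0 * w 2 - v 2 * w 0) +
      u 2 * (v 0 * w 1 - v 1 * w 0) : ℤ) : ℝ) := by
    rw [Matrix.det_fin_three, hM]
    simp only [Matrix.of_apply, Matrix.cons_val_zero, Matrix.cons_val_one, Matrix.cons_val]
    push_cast
    ring
  have hdet' : M.det ≠ 0 := by
    rw [hdet]; exact_mod_cast h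
  have hrows : LinearIndependent ℝ (fun r => M r) :=
    Matrix.linearIndependent_rows_iff_isUnit.2 ((Matrix.isUnit_iff_isUnit_det M).2 hdet'.isUnit)
  refine LinearIndependent.of_comp (WithLp.linearEquiv 2 ℝ (Fin 3 → ℝ)).toLinearMap ?_
  have hfun : ⇑(WithLp.linearEquiv 2 ℝ (Fin 3 → ℝ)).toLinearMap ∘
      (![(WithLp.toLp 2 fun i : Fin 3 => ((u i : ℤ) : ℝ) : EuclideanSpace ℝ (Fin 3)),
        (WithLp.toLp 2 fun i : Fin 3 => ((v i : ℤ) : ℝ) : EuclideanSpace ℝ (Fin 3)),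
        (WithLp.toLp 2 fun i : Fin 3 => ((w i : ℤ) : ℝ) : EuclideanSpace ℝ (Fin 3))] :
        Fin 3 → EuclideanSpace ℝ (Fin 3)) = fun r => M r := by
    funext r
    fin_cases r <;> rfl
  rw [hfun]
  exact hrows

/-- Vectors with equal inner products against a linearly independent triple of `ℝ³` are equal.
[folklore] -/
theorem eq_of_inner_eq_of_linearIndependent {v : Fin 3 → EuclideanSpace ℝ (Fin 3)}
    (hv : LinearIndependent ℝ v) {x x' : EuclideanSpace ℝ (Fin 3)}
    (h : ∀ k, ⟪x, v k⟫_ℝ = ⟪x', v k⟫_ℝ) : x = x' := by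
  have hcard : Fintype.card (Fin 3) = Module.finrank ℝ (EuclideanSpace ℝ (Fin 3)) := by simp
  set b := basisOfLinearIndependentOfCardEqFinrank hv hcard with hb
  have hbv : ∀ k, b k = v k := fun k => by
    rw [hb, coe_basisOfLinearIndependentOfCardEqFinrank]
  have hw : ∀ k, ⟪x - x', b k⟫_ℝ = 0 := fun k => by
    rw [hbv, inner_sub_left, h k, sub_self]
  have hall : ∀ u : EuclideanSpace ℝ (Fin 3), ⟪x - x', u⟫_ℝ = 0 := fun u => by
    rw [← b.sum_repr u, inner_sum]
    simp [inner_smul_right, hw]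
  have : x - x' = 0 := inner_self_eq_zero.1 (hall (x - x'))
  exact sub_eq_zero.1 this

/-! ### Three good directions off a finite set -/

/-- **Three good lattice directions off a finite set.** For every finite family `y : Fin m → ℝ³`
there is a finite set `F ⊆ ℝ³` such that every `x ∉ F` admits three linearly independent lattice
mirror normals `n₁, n₂, n₃` with `⟪y i, n_k⟫ ≠ ⟪x, n_k⟫` for all `i` and `k` (any five of the nine
normals span `ℝ³`; a point whose bad normals contain an independent triple solves one of finitely
many uniquely solvable `3 × 3` systems). [cite: GlimmJaffe1987, §6.1] -/
theorem exists_finset_three_good_latticeNormals {m : ℕ} (y : Fin m → EuclideanSpace ℝ (Fin 3)) :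
    ∃ F : Finset (EuclideanSpace ℝ (Fin 3)), ∀ x, x ∉ F →
      ∃ n₁ n₂ n₃ : EuclideanSpace ℝ (Fin 3), n₁ ∈ latticeMirrorNormals (Fin 3) ∧
        n₂ ∈ latticeMirrorNormals (Fin 3) ∧ n₃ ∈ latticeMirrorNormals (Fin 3) ∧
        LinearIndependent ℝ ![n₁, n₂, n₃] ∧
        (∀ i, ⟪y i, n₁⟫_ℝ ≠ ⟪x, n₁⟫_ℝ) ∧ (∀ i, ⟪y i, n₂⟫_ℝ ≠ ⟪x, n₂⟫_ℝ) ∧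
        (∀ i, ⟪y i, n₃⟫_ℝ ≠ ⟪x, n₃⟫_ℝ) := by
  classical
  -- the nine normals
  set nE : Fin 9 → EuclideanSpace ℝ (Fin 3) := fun k =>
    WithLp.toLp 2 fun i : Fin 3 => (((![![1, 0, 0], ![0, 1, 0], ![0, 0, 1], ![1, 1, 0], ![1, 0, 1], ![0, 1, 1],
      ![1, -1, 0], ![1, 0, -1], ![0, 1, -1]] : Fin 9 → Fin 3 → ℤ) k i : ℤ) : ℝ) with hnE
  -- the candidate solutions of the `3 × 3` systems
  set sol : (Fin 9 × Fin 9 × Fin 9) × (Fin m × Fin m × Fin m) → EuclideanSpace ℝ (Fin 3) :=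
    fun p => if hp : ∃ x : EuclideanSpace ℝ (Fin 3), ⟪x, nE p.1.1⟫_ℝ = ⟪y p.2.1, nE p.1.1⟫_ℝ ∧
        ⟪x, nE p.1.2.1⟫_ℝ = ⟪y p.2.2.1, nE p.1.2.1⟫_ℝ ∧ ⟪x, nE p.1.2.2⟫_ℝ = ⟪y p.2.2.2, nE p.1.2.2⟫_ℝ
      then hp.choose else 0 with hsol
  refine ⟨Finset.univ.image sol, fun x hx => ?_⟩
  -- the bad normals at `x`
  set B : Fin 9 → Bool := fun k => decide (∃ i, ⟪y i, nE k⟫_ℝ = ⟪x, nE k⟫_ℝ) with hBdef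
  have hBad : ∀ k, B k = true ↔ ∃ i, ⟪y i, nE k⟫_ℝ = ⟪x, nE k⟫_ℝ := fun k => by
    rw [hBdef]; exact decide_eq_true_iff
  -- no listed independent triple is entirely bad, so some listed independent triple is good
  obtain ⟨t, ht, hg1, hg2, hg3⟩ := cover_of_cover_bool _ nineNormals_cover_bool B (by
      rintro t ht ⟨hb1, hb2, hb3⟩
      obtain ⟨i, hi⟩ := (hBad _).1 hb1
      obtain ⟨j, hj⟩ := (hBad _).1 hb2
      obtain ⟨k, hk⟩ := (hBad _).1 hb3
      have hp : ∃ x' : EuclideanSpace ℝ (Fin 3), ⟪x', nE t.1⟫_ℝ = ⟪y i, nE t.1⟫_ℝ ∧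
          ⟪x', nE t.2.1⟫_ℝ = ⟪y j, nE t.2.1⟫_ℝ ∧ ⟪x', nE t.2.2⟫_ℝ = ⟪y k, nE t.2.2⟫_ℝ :=
        ⟨x, hi.symm, hj.symm, hk.symm⟩
      have hsolx : sol (t, (i, j, k)) = x := by
        rw [hsol]; dsimp only
        rw [dif_pos hp]
        obtain ⟨e1, e2, e3⟩ := hp.choose_spec
        refine eq_of_inner_eq_of_linearIndependent
          (linearIndependent_of_det3_ne_zero (nineNormals_det_ne_zero t ht)) fun l => ?_
        fin_cases l
        · exact e1.trans hi
        · exact e2.trans hj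
        · exact e3.trans hk
      exact hx (Finset.mem_image.2 ⟨(t, (i, j, k)), Finset.mem_univ _, hsolx⟩))
  have hgood : ∀ {k : Fin 9}, B k = false → ∀ i, ⟪y i, nE k⟫_ℝ ≠ ⟪x, nE k⟫_ℝ := by
    intro k hk i hi
    have : B k = true := (hBad k).2 ⟨i, hi⟩
    rw [hk] at this
    exact Bool.false_ne_true this
  exact ⟨nE t.1, nE t.2.1, nE t.2.2, nineNormals_mem _, nineNormals_mem _, nineNormals_mem _,
    linearIndependent_of_det3_ne_zero (nineNormals_det_ne_zero t ht), hgood hg1, hgood hg2, hgood hg3⟩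

end Literature.MathematicalPhysics.QuantumFieldTheory

end
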